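import Summits.CriticalPhenomena.PercolationContinuityZ3.Theorems.PercNearOneGluingNoHeavyLowerTailQ7PsiDomReduction
import Literature.Probability.Percolation.KozmaNitzanSeparatingTriple
import HarnessLib

/-!
# Kozma–Nitzan's Question 8 for three relays — the two `x`-pieces of the pocket-designated certificate:
# (P1*D) = t·(P1**-D) + (1−t)·(BHK-D) (real arithmetic), and the set-avoidance attachment lemma (BHK-D), PROVED

Support file (`--supports stmt-CriticalPhenomena-4575`, closed), prover `prim-lf-2` (gen 16).  No definitions, no named
facts, no sorries; standard axioms.  Companion of `…KnQuestion8PocketCertificate.lean` (bookkeeping of the certificate: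
`PocketCert.opart_of_pocketHalves`, `gpsi_three_pocket_of_dom`, `block41_three_of_pocketCert`); memo
`prim-lf-2/POCKET-CERT-gen16.md`.

Notation (one bond percolation `μ = prodBernoulli w`; observer `o`, owner `x`, second strong relay `y`, weak relay `z`):
`E1 = {x↮y} ∩ {x↮z}`, `F = {x↔y} ∩ {x↮z}`, `E2 = {y↮x} ∩ {y↮z}`, pocket `Dp` (for Question 8: `Dq = {o↮x} ∩ {o↮y} ∩ {o↮z}`),
`a = μ(x↔o ∩ E1)`, `d = μ(x↔o ∩ F)`, `b = μ(y↔o ∩ E2)`.  The `x`-half of the pocket certificate,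
  (P1*D)  `λ_D ∫_{Dp ∩ {x↮z}} G(C x) ≤ ∫_{x↔o ∩ E1} G(C x) + t_D ∫_{x↔o ∩ F} G(C x)`,
  `t_D·(a μ(Dp∩E2) + b μ(Dp∩E1)) = a μ(Dp∩E2)`, `λ_D μ(Dp∩{x↮z}) = a + t_D d`,
is `t_D` times the POCKET COVARIANCE COMPARISON
  (P1**-D) `μ(Dp∩E2)·[μ(Dp∩{x↮z}) ∫_{x↔o,x↮z} G − μ(x↔o,x↮z) ∫_{Dp∩{x↮z}} G] ≥ b·[μ(Dp∩E1) ∫_{Dp∩F} G − μ(Dp∩F) ∫_{Dp∩E1} G]`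
plus `(1 − t_D)` times the ATTACHMENT comparison (BHK-D) `μ(Dp∩E1) ∫_{x↔o∩E1} G ≥ a ∫_{Dp∩E1} G` — exactly as the tree's
`Q7Psi.p1star_of_cov` writes (P1*) as `t*·(P1**) + (1−t*)·(BHK Thm 1.3)` (`Dp = univ`).
* `PocketCert.p1star_pocket_of_pieces` — this real-arithmetic identity/implication;
* `PocketCert.attach_of_setAvoid` — (BHK-D) for the Question-8 pocket `Dq`, every monotone `G` of the vertex cluster:
  `μ(x↔o ∩ E1) · ∫_{Dq ∩ E1} G(C x) ≤ μ(Dq ∩ E1) · ∫_{x↔o ∩ E1} G(C x)`, i.e.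
  `E[G(C x) | o ∈ C x, x↮{y,z}] ≥ E[G(C x) | o ↮ {x,y,z}, x ↮ {y,z}]` ("pocket-conditioning never raises the owner's
  cluster above observer-conditioning").  Proof: `{x↔o}∩E1` and `Dq∩E1` partition `{S ↮ T}` for the vertex SETS `S = {x,o}`,
  `T = {y,z}`, and on `{S↮T}` both `G(C x)` and `1{o ∈ C x}` are increasing functions of the edge cluster `C_S` of `S`
  (`KNSep.reachable_iff_cluster`); van den Berg–Häggström–Kahn's Theorem 2.1 at `q = 1`
  (`BHK2006_setClusterConditionalPositiveAssociation`, Remark 1: "`s`, `t` may be replaced by sets of vertices") says they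
  are positively correlated given `{S ↮ T}`.  (The termwise version "for each pocket `W`" is FALSE — memo §2.4; the set form
  is what makes the sum over pockets work.)
Census (prim-lf-2 gen 16, exact engine, ≈ 10⁴ graphs n ≤ 8, five pocket families): (P1**-D), (BHK-D), (P1*D) 0 violations each.
[cite: KozmaNitzan2024, Question 8 (§5.5 p. 36), §5.1 (pp. 31–32)]
[cite: VandenbergHaggstromKahn2005, Thm. 2.1 (p. 9), Remark 1 after Thm. 1.2 (p. 5), Thm. 1.3 (p. 6)]
-/

namespace Summit.CriticalPhenomena.PercolationContinuityZ3.Theorems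

open MeasureTheory Set Literature.Probability.LatticeModels Literature.Probability.Percolation
open scoped Classical
open KNPreFKG

noncomputable section

namespace PocketCert

variable {V : Type*} [Fintype V]

/-- **(P1*D) at the split `t_D` from its two `x`-pieces (real arithmetic).**  Reals: `IxoE1 = ∫_{x↔o ∩ E1} G(C x)`,
`IxoF = ∫_{x↔o ∩ F} G(C x)` (`E1 = {x↮y,x↮z}`, `F = {x↔y,x↮z}`), `IDE1 = ∫_{Dp ∩ E1} G`, `IDF = ∫_{Dp ∩ F} G`; masses
`a = μ(x↔o ∩ E1)`, `d = μ(x↔o ∩ F)`, `b = μ(y↔o ∩ E2)`, `mDE1 = μ(Dp∩E1)`, `mDF = μ(Dp∩F)`, `mDE2 = μ(Dp∩E2)` (so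
`μ(Dp ∩ {x↮z}) = mDE1 + mDF`, `μ(x↔o ∩ {x↮z}) = a + d`).  If the split `t ∈ [0,1]` satisfies
`t·(a·mDE2 + b·mDE1) = a·mDE2`, the multiplier `λ·(mDE1 + mDF) = a + t d`, `mDE1, mDE2 > 0`, and the two pieces hold —
(BHK-D) `a·IDE1 ≤ mDE1·IxoE1` and (P1**-D) `b·(mDE1·IDF − mDF·IDE1) ≤ mDE2·((mDE1+mDF)·(IxoE1+IxoF) − (a+d)·(IDE1+IDF))` —
then (P1*D) `λ·(IDE1 + IDF) ≤ IxoE1 + t·IxoF`.  (Identity: `mDE1·mDE2·[(P1*D)·(mDE1+mDF)] = t·mDE1·(P1**-D) +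
(mDE1+mDF)(1−t)·mDE2·(BHK-D)`, as in `Q7Psi.p1star_of_cov`.) [cite: KozmaNitzan2024, §5.1 (pp. 31–32)] -/
theorem p1star_pocket_of_pieces (IxoE1 IxoF IDE1 IDF a d b mDE1 mDF mDE2 t lam : ℝ)
    (ht0 : 0 ≤ t) (ht1 : t ≤ 1) (hE1 : 0 < mDE1) (hE2 : 0 < mDE2) (hF0 : 0 ≤ mDF)
    (ht : t * (a * mDE2 + b * mDE1) = a * mDE2) (hlam : lam * (mDE1 + mDF) = a + t * d)
    (hBHK : a * IDE1 ≤ mDE1 * IxoE1)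
    (hcov : b * (mDE1 * IDF - mDF * IDE1) ≤ mDE2 * ((mDE1 + mDF) * (IxoE1 + IxoF) - (a + d) * (IDE1 + IDF))) :
    lam * (IDE1 + IDF) ≤ IxoE1 + t * IxoF := by
  -- multiply the goal by `mDE1 * mDE2 * (mDE1 + mDF) > 0` and use the identity of the docstring
  have hD : 0 < mDE1 + mDF := by linarith
  have hpos : 0 < mDE1 * mDE2 * (mDE1 + mDF) := by positivity
  rw [← sub_nonneg]
  have e1 : lam * (IDE1 + IDF) * (mDE1 + mDF) = (a + t * d) * (IDE1 + IDF) := by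
    rw [mul_assoc, mul_comm (IDE1 + IDF), ← mul_assoc, hlam]
  have e2 : (1 - t) * a * mDE2 = t * b * mDE1 := by linarith [ht]
  have key : mDE1 * mDE2 * (mDE1 + mDF) * (IxoE1 + t * IxoF - lam * (IDE1 + IDF)) =
      t * mDE1 * (mDE2 * ((mDE1 + mDF) * (IxoE1 + IxoF) - (a + d) * (IDE1 + IDF)) - b * (mDE1 * IDF - mDF * IDE1)) +
        (mDE1 + mDF) * (1 - t) * mDE2 * (mDE1 * IxoE1 - a * IDE1) := by
    linear_combination (-(mDE1 * mDE2)) * e1 + (mDF * IDE1 - mDE1 * IDF) * e2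
  have h1 : 0 ≤ t * mDE1 * (mDE2 * ((mDE1 + mDF) * (IxoE1 + IxoF) - (a + d) * (IDE1 + IDF)) -
      b * (mDE1 * IDF - mDF * IDE1)) := mul_nonneg (mul_nonneg ht0 hE1.le) (sub_nonneg.2 hcov)
  have h2 : 0 ≤ (mDE1 + mDF) * (1 - t) * mDE2 * (mDE1 * IxoE1 - a * IDE1) :=
    mul_nonneg (mul_nonneg (mul_nonneg hD.le (sub_nonneg.2 ht1)) hE2.le) (sub_nonneg.2 hBHK)
  have h3 : 0 ≤ mDE1 * mDE2 * (mDE1 + mDF) * (IxoE1 + t * IxoF - lam * (IDE1 + IDF)) := by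
    rw [key]; exact add_nonneg h1 h2
  exact (mul_nonneg_iff_of_pos_left hpos).1 h3

/-- **The set-avoidance attachment lemma (BHK-D for the Question-8 pocket).**  Observer `o`, owner `x`, avoided relays
`y, z`, `E1 = {x↮y} ∩ {x↮z}`, `Dq = {o↮x} ∩ {o↮y} ∩ {o↮z}`, `F` a monotone function of the vertex cluster.  Then
`μ({x↔o} ∩ E1) · ∫_{Dq ∩ E1} F(C x) ≤ μ(Dq ∩ E1) · ∫_{{x↔o} ∩ E1} F(C x)`, i.e.
`E[F(C x) | o ∈ C x, x ↮ {y,z}] ≥ E[F(C x) | o ↮ {x,y,z}, x ↮ {y,z}]`: pocket-conditioning never raises the owner's cluster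
above observer-conditioning.  Proof: with `S = {x,o}`, `T = {y,z}`, `{S ↮ T} = ({x↔o} ∩ E1) ⊔ (Dq ∩ E1)`, and on `{S↮T}`
both `F(C x)` and `1{o ∈ C x}` are increasing functions of the edge cluster `C_S` of the set `S` — van den Berg–Häggström–
Kahn's Theorem 2.1 at `q = 1` (`BHK2006_setClusterConditionalPositiveAssociation`) makes them positively correlated
given `{S ↮ T}`, which is the claim. [cite: VandenbergHaggstromKahn2005, Thm. 2.1 (p. 9), Remark 1 after Thm. 1.2 (p. 5)]
[cite: KozmaNitzan2024, Question 8 (§5.5 p. 36)] -/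
theorem attach_of_setAvoid (w : Sym2 V → unitInterval) (o x y z : V) (F : Set V → ℝ)
    (hF : ∀ S T : Set V, S ⊆ T → F S ≤ F T) :
    (prodBernoulli w).real (openConn x o ∩ {ω | ¬ (openGraph ω).Reachable x y} ∩ {ω | ¬ (openGraph ω).Reachable x z}) *
        ∫ ω in ({ω : BondConfig V | ¬ (openGraph ω).Reachable o x} ∩ {ω | ¬ (openGraph ω).Reachable o y} ∩
            {ω | ¬ (openGraph ω).Reachable o z}) ∩
          ({ω | ¬ (openGraph ω).Reachable x y} ∩ {ω | ¬ (openGraph ω).Reachable x z}), F (openCluster ω x) ∂(prodBernoulli w) ≤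
      (prodBernoulli w).real (({ω : BondConfig V | ¬ (openGraph ω).Reachable o x} ∩ {ω | ¬ (openGraph ω).Reachable o y} ∩
            {ω | ¬ (openGraph ω).Reachable o z}) ∩
          ({ω | ¬ (openGraph ω).Reachable x y} ∩ {ω | ¬ (openGraph ω).Reachable x z})) *
        ∫ ω in openConn x o ∩ {ω | ¬ (openGraph ω).Reachable x y} ∩ {ω | ¬ (openGraph ω).Reachable x z},
          F (openCluster ω x) ∂(prodBernoulli w) := by
  classical
  set μ := prodBernoulli w with hμ
  have hmeas : ∀ S' : Set (BondConfig V), MeasurableSet S' := fun _ => MeasurableSet.of_discrete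
  have hint : ∀ (g : BondConfig V → ℝ) (S' : Set (BondConfig V)), IntegrableOn g S' μ :=
    fun g S' => (Integrable.of_finite).integrableOn
  set S : Set V := {x, o} with hS
  set T : Set V := {y, z} with hT
  set D : Set (BondConfig V) := {ω : BondConfig V | ∀ s ∈ S, ∀ t ∈ T, ¬ (openGraph ω).Reachable s t} with hD
  set O : Set (BondConfig V) := openConn x o ∩ {ω | ¬ (openGraph ω).Reachable x y} ∩ {ω | ¬ (openGraph ω).Reachable x z}
    with hO
  set P : Set (BondConfig V) := ({ω : BondConfig V | ¬ (openGraph ω).Reachable o x} ∩ {ω | ¬ (openGraph ω).Reachable o y} ∩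
      {ω | ¬ (openGraph ω).Reachable o z}) ∩ ({ω | ¬ (openGraph ω).Reachable x y} ∩ {ω | ¬ (openGraph ω).Reachable x z})
    with hP
  -- the two monotone functions of the edge cluster of `S`
  set Fe : Set (Sym2 V) → ℝ := fun C => F (openCluster C x) with hFe
  set Ge : Set (Sym2 V) → ℝ := fun C => (openCluster C x).indicator (1 : V → ℝ) o with hGe
  have hFe_mono : Monotone Fe := fun C C' hCC' => hF _ _ (openCluster_mono hCC' x)
  have hGe_mono : Monotone Ge := by
    intro C C' hCC'
    simp only [hGe]
    by_cases h : o ∈ openCluster C x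
    · rw [indicator_of_mem h, indicator_of_mem (openCluster_mono hCC' x h)]
    · rw [indicator_of_notMem h]
      by_cases h' : o ∈ openCluster C' x
      · rw [indicator_of_mem h']; simp
      · rw [indicator_of_notMem h']
  -- on every configuration, the clusters of `x` read off `C_S` and off `ω` agree (`x ∈ S`)
  have hxS : x ∈ S := by simp [hS]
  have hcl : ∀ ω : BondConfig V, openCluster (⋃ s ∈ S, openEdgeCluster ω s) x = openCluster ω x := by
    intro ω; ext a
    exact (KNSep.reachable_iff_cluster ω S hxS a).symm
  have hFe_eq : ∀ ω : BondConfig V, Fe (⋃ s ∈ S, openEdgeCluster ω s) = F (openCluster ω x) := by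
    intro ω; simp only [hFe, hcl ω]
  have hGe_eq : ∀ ω : BondConfig V, Ge (⋃ s ∈ S, openEdgeCluster ω s) = (openConn x o : Set (BondConfig V)).indicator 1 ω := by
    intro ω; simp only [hGe, hcl ω]
    by_cases h : (openGraph ω).Reachable x o
    · rw [indicator_of_mem (show o ∈ openCluster ω x from h), indicator_of_mem (show ω ∈ openConn x o from h)]
      simp
    · rw [indicator_of_notMem (show o ∉ openCluster ω x from h), indicator_of_notMem (show ω ∉ openConn x o from h)]
  -- the conditioning event and its two parts
  have hDeq : D = O ∪ P := by
    ext ω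
    simp only [hD, hO, hP, hS, hT, mem_setOf_eq, mem_inter_iff, mem_union, mem_insert_iff, mem_singleton_iff,
      openConn, forall_eq_or_imp, forall_eq]
    constructor
    · rintro ⟨⟨hxy, hxz⟩, ⟨hoy, hoz⟩⟩
      by_cases hxo : (openGraph ω).Reachable x o
      · exact Or.inl ⟨⟨hxo, hxy⟩, hxz⟩
      · exact Or.inr ⟨⟨⟨fun h => hxo h.symm, hoy⟩, hoz⟩, hxy, hxz⟩
    · rintro (⟨⟨hxo, hxy⟩, hxz⟩ | ⟨⟨⟨hox, hoy⟩, hoz⟩, hxy, hxz⟩)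
      · exact ⟨⟨hxy, hxz⟩, fun hoy => hxy (hxo.trans hoy), fun hoz => hxz (hxo.trans hoz)⟩
      · exact ⟨⟨hxy, hxz⟩, hoy, hoz⟩
  have hOP : Disjoint O P := by
    rw [Set.disjoint_left]
    rintro ω ⟨⟨hxo, -⟩, -⟩ ⟨⟨⟨hox, -⟩, -⟩, -⟩
    exact hox (SimpleGraph.Reachable.symm hxo)
  have hDO : D ∩ openConn x o = O := by
    rw [hDeq, union_inter_distrib_right]
    have h1 : O ∩ openConn x o = O := inter_eq_left.2 fun ω hω => hω.1.1
    have h2 : P ∩ openConn x o = ∅ := by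
      ext ω
      simp only [mem_inter_iff, mem_empty_iff_false, iff_false, not_and]
      intro hω hxo
      exact hω.1.1.1 (SimpleGraph.Reachable.symm hxo)
    rw [h1, h2, union_empty]
  -- Theorem 2.1 (q = 1) for the sets `S, T`
  have key := BHK2006_setClusterConditionalPositiveAssociation w S T Fe Ge hFe_mono hGe_mono
  have eF : ∫ ω in D, Fe (⋃ s ∈ S, openEdgeCluster ω s) ∂μ = ∫ ω in O, F (openCluster ω x) ∂μ + ∫ ω in P, F (openCluster ω x) ∂μ := by
    simp_rw [hFe_eq]
    rw [hDeq, setIntegral_union hOP (hmeas _) (hint _ _) (hint _ _)]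
  have eG : ∫ ω in D, Ge (⋃ s ∈ S, openEdgeCluster ω s) ∂μ = μ.real O := by
    simp_rw [hGe_eq]
    rw [setIntegral_indicator_one_eq μ D (openConn x o), hDO]
  have eFG : ∫ ω in D, Fe (⋃ s ∈ S, openEdgeCluster ω s) * Ge (⋃ s ∈ S, openEdgeCluster ω s) ∂μ =
      ∫ ω in O, F (openCluster ω x) ∂μ := by
    simp_rw [hFe_eq, hGe_eq]
    rw [setIntegral_mul_indicator_one μ D (openConn x o) (fun ω => F (openCluster ω x)), hDO]
  have eD : μ.real D = μ.real O + μ.real P := by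
    rw [hDeq, measureReal_union hOP (hmeas _)]
  rw [eF, eG, eFG, eD] at key
  -- key : (I_O + I_P) * μ O ≤ (μ O + μ P) * I_O
  have : μ.real O * ∫ ω in P, F (openCluster ω x) ∂μ ≤ μ.real P * ∫ ω in O, F (openCluster ω x) ∂μ := by nlinarith [key]
  simpa only [hO, hP] using this

end PocketCert

end

end Summit.CriticalPhenomena.PercolationContinuityZ3.Theorems
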